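import Summits.HodgeConjecture.HodgeConjecture.Theses.ELineTransport
import Summits.HodgeConjecture.HodgeConjecture.Theorems.AnchorTransportIsoInvariance

/-!
# Birth skeleton — `ELineTransport.EClassTransport` (stmt-HodgeConjecture-19049), piece X₃ of the
# BC2 redirect of `IsogenyInvariance` (stmt-HodgeConjecture-12550): the VARIATIONAL E-LINE

LINE `birth` (crux-strategist). The route's own mechanism for the transport proper (μ-stable
hyperholomorphic carrier at a CM anchor + Verbitsky transport along chains of generic E-twistor
lines, informal cruxes stmt-12672 / stmt-12766) cannot be typed yet (no Chern classes of bundles into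
`complexBetti`). Its ALGEBRAIC SHADOW can: inside one E-isometry class the PROJECTIVE members are
not scattered — for an E-structure `J` on `Λ = H²(K3, ℤ)` with `E₊` of signature `(3,8)` (TC) and an
E-line `N₁ = E·h` through an ample class, the locus `D_{E,N₁} = {σ ∈ E₊,ℂ ∩ N₁^⊥ : σ² = 0, σσ̄ > 0}`
is an 8-dimensional Hermitian symmetric piece whose arithmetic quotient is (a component of) the
real-multiplication sublocus of the moduli space of `N₁`-polarised K3 surfaces: an IRREDUCIBLE smooth
quasi-projective base carrying the universal family `𝒮`, on which `J` is a MONODROMY-INVARIANT flat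
Hodge endomorphism (monodromy preserving `E₊,ℂ ∩ N₁^⊥` commutes with `J`), hence — theorem of the
fixed part — its Künneth class is the restriction of ONE global rational class `A` on the total space
of the family of squares `𝒳 = 𝒮 ×_B 𝒮 → B`, of type `(2,2)` on every fibre; Picard-18 (CM, `T` of
rank 4 with CM by a quartic field `K ⊃ E`) points are DENSE in `B`, and there HC of the square is
known (Buskin 2019 / Huybrechts 2019, the tree's `Buskin2019_hodgeConjectureFor_square_of_CM`), so
`A` is algebraic on some fibre. This is `stub_EAnchoredFamily` (known mathematics, heavy: lattice-
polarised K3 moduli with level structure, Baily–Borel, Torelli, fixed part). What is then left of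
`EClassTransport` is EXACTLY Grothendieck's variational Hodge conjecture for fibrewise-Hodge rational
`(2,2)`-classes on smooth projective families whose fibres are squares of projective K3 surfaces —
`stub_variationalHodge_K3Squares`, the special case `n = 4, p = 2, K3-square fibres` of the
AnchorTransport route's crux `VariationalHodge` (stmt-HodgeConjecture-1076) — and the PROVED support
`AnchorTransport.IsoInvariance` (`Theorems.anchorTransport_isoInvariance_proof`) moves algebraicity
across `S₁ ⊗ S₁ ≅ 𝒳_{s₁}`.

Why the variational form is EASIER than the crux as typed (and than HC): (i) one explicit FLAT class
along ALGEBRAIC families — the home of semiregularity (Bloch 1972; Buchweitz–Flenner; Pridham) and of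
the algebraicity-locus structure theorem `charlesSchnell_algebraicityLocus_iUnion_closed` (tree): the
locus where `A|_{𝒳_t}` is algebraic is a countable union of Zariski-closed subsets of the irreducible
base, so by Baire it is EVERYTHING as soon as it contains a Euclidean-open set; (ii) the anchors are
DENSE (CM points), so it suffices that the algebraicity locus be open at ONE Picard-18 CM point, i.e.
that ONE algebraic cycle `Z₀` on `S₀ × S₀` with `[Z₀] = y·κ(J₀) + x[Δ] + z·fibres (+ N₁ ⊗ N₁ only)`,
`y ≠ 0` — the UNPADDED class of the informal crux CarrierStability — be semiregular / unobstructed in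
the E-directions. No non-projective K3 surface, no hyperkähler metric, no bundle is needed.

`EClassTransport_of : EClassTransport` is the kernel-checked composition (stubs used by name); the anchor `S₀`, `g`, `g₄` handed by the crux
are not used by this line (it proves the transport for every projective target with TC).
-/

namespace Summit.HodgeConjecture.HodgeConjecture.Cruxes.EClassTransport.Birth

set_option linter.dupNamespace false

open scoped Manifold
open CategoryTheory AlgebraicGeometry MonoidalCategory
open Literature.AlgebraicGeometry.Motives Literature.AlgebraicGeometry.HodgeTheory
open Literature.AlgebraicTopology.SingularHomology
open Summit.HodgeConjecture.HodgeConjecture.Theses.ELineTransport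

/-- STUB (known mathematics, L–XL): **E-classes are ANCHORED in one irreducible algebraic family of
K3 squares.** For a projective K3 surface `S₁` with an E-structure `J₁` (rational, `J₁ ∘ J₁ = m`,
cup-self-adjoint, `+√m` on `H^{2,0}`) satisfying TC, there are a smooth projective family
`f : 𝒳 ⟶ B` of relative dimension `4` over a smooth irreducible base all of whose fibres are squares
of projective K3 surfaces, a global class `A ∈ H⁴(𝒳(ℂ); ℂ)` which is rational of type `(2,2)` on
every fibre, a point `s₁` with `S₁ ⊗ S₁ ≅ 𝒳_{s₁}` under which (a scalar multiple of) `A|_{𝒳_{s₁}}`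
acts as `J₁` through the Gysin correspondence action, and a point `s₀` (a Picard-18 CM member, where
HC of the square is Buskin–Huybrechts) at which `A|_{𝒳_{s₀}}` is algebraic. (Real-multiplication
sublocus of the `N₁`-polarised moduli space, `N₁ = E·h`; universal family with level structure;
theorem of the fixed part; Torelli; density of CM points.)
[cite: BayerFluckigerVanGeemenSchuett2025, Thm. 1.3] [cite: VanGeemen2008RM, §3]
[cite: Huybrechts2019, Cor. 0.4] [cite: CharlesSchnell2014Notes, Prop. 11.3.5] -/
theorem stub_EAnchoredFamily :
    ∀ (μ : OrientationFamily), μ.HasPoincareDuality → ∀ (S₁ : SchemeOver ℂ)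
      (hS₁ : (IsSmoothProjective 2 S₁ ∧ Subsingleton (structureSheafCohomology S₁.left 1) ∧
        ∃ (A : HodgeModel 2 S₁) (η : Literature.Geometry.Kaehler.MForm 𝓘(ℝ, A.model) A.carrier ℂ 2),
          Literature.Geometry.Kaehler.IsHolomorphicInCharts η ∧ ∀ x, η x ≠ 0)),
      ∀ m : ℕ, ¬ IsSquare m → ∀ (J₁ : complexBetti S₁ 2 →ₗ[ℂ] complexBetti S₁ 2),
        ((∀ c, IsRationalClass c → IsRationalClass (J₁ c)) ∧ (∀ c, J₁ (J₁ c) = (m : ℂ) • c) ∧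
          (∀ a b, cupProduct rfl (J₁ a) b = cupProduct rfl a (J₁ b)) ∧
          (∀ c, IsOfHodgeType 2 S₁ 2 2 0 c → J₁ c = (Real.sqrt m : ℂ) • c)) →
        (∀ v ∈ Submodule.span ℝ {c : complexBetti S₁ 2 | IsRationalClass c},
          J₁ v = -((Real.sqrt m : ℂ) • v) → cupProduct rfl v v = 0 → v = 0) →
        ∃ (𝒳 B : SchemeOver ℂ) (f : 𝒳 ⟶ B) (s₁ s₀ : ComplexPoints B)
          (e : (S₁ ⊗ S₁) ≅ fiberOver f s₁) (A : complexBetti 𝒳 (2 * 2)) (t : ℂ),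
          IsSmoothProjectiveFamily f 4 ∧ IrreducibleSpace B.left ∧ AlgebraicGeometry.Smooth B.hom ∧
          (∀ s : ComplexPoints B, ∃ (S' : SchemeOver ℂ),
            (IsSmoothProjective 2 S' ∧ Subsingleton (structureSheafCohomology S'.left 1) ∧
              ∃ (A' : HodgeModel 2 S') (η : Literature.Geometry.Kaehler.MForm 𝓘(ℝ, A'.model) A'.carrier ℂ 2),
                Literature.Geometry.Kaehler.IsHolomorphicInCharts η ∧ ∀ x, η x ≠ 0) ∧
            Nonempty ((S' ⊗ S') ≅ fiberOver f s)) ∧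
          (∀ s : ComplexPoints B, IsRationalClass (complexBetti.map (fiberι f s) (2 * 2) A) ∧
            IsOfHodgeType 4 (fiberOver f s) (2 * 2) 2 2 (complexBetti.map (fiberι f s) (2 * 2) A)) ∧
          (∀ x : complexBetti S₁ 2, J₁ x =
            complexGysin μ (IsSmoothProjective.tensor_holds hS₁.1 hS₁.1) hS₁.1
              (SemiCartesianMonoidalCategory.fst S₁ S₁) (rfl : 2 + 2 * 2 + 2 * 2 = 2 + 2 * (2 + 2))
              (cupProduct (rfl : 2 + 2 * 2 = 2 + 2 * 2)
                (complexBetti.map (SemiCartesianMonoidalCategory.snd S₁ S₁) 2 x)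
                (t • complexBetti.map e.hom (2 * 2) (complexBetti.map (fiberι f s₁) (2 * 2) A)))) ∧
          complexBetti.map (fiberι f s₀) (2 * 2) A ∈ algebraicClasses (fiberOver f s₀) 2 := by
  sorry

/-- STUB (the research content of this line, open; implied by HC): **the variational Hodge
conjecture for K3-square families** — on a smooth projective family of relative dimension `4` over a
smooth irreducible base all of whose fibres are squares of projective K3 surfaces, a global class of
`H⁴` that is rational of type `(2,2)` on every fibre and algebraic on ONE fibre is algebraic on EVERY
fibre. Special case `n = 4`, `p = 2`, K3-square fibres of the AnchorTransport crux `VariationalHodge`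
(stmt-HodgeConjecture-1076; Grothendieck 1966 fn. 13 = Charles–Schnell Conj. 11.3.1); by
`charlesSchnell_algebraicityLocus_iUnion_closed` + Baire + density of CM points it reduces to the
OPENNESS of the algebraicity locus at one Picard-18 CM point (semiregular unpadded representative).
[cite: CharlesSchnell2014Notes, Conj. 11.3.1 and Prop. 11.3.11] [cite: Bloch1972Semiregularity, Thm. 7.3]
[cite: Grothendieck1966, footnote 13] -/
theorem stub_variationalHodge_K3Squares :
    ∀ ⦃𝒳 B : SchemeOver ℂ⦄ (f : 𝒳 ⟶ B), IsSmoothProjectiveFamily f 4 → IrreducibleSpace B.left →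
      AlgebraicGeometry.Smooth B.hom →
      (∀ s : ComplexPoints B, ∃ (S' : SchemeOver ℂ),
        (IsSmoothProjective 2 S' ∧ Subsingleton (structureSheafCohomology S'.left 1) ∧
          ∃ (A' : HodgeModel 2 S') (η : Literature.Geometry.Kaehler.MForm 𝓘(ℝ, A'.model) A'.carrier ℂ 2),
            Literature.Geometry.Kaehler.IsHolomorphicInCharts η ∧ ∀ x, η x ≠ 0) ∧
        Nonempty ((S' ⊗ S') ≅ fiberOver f s)) →
      ∀ (A : complexBetti 𝒳 (2 * 2)),
        (∀ s : ComplexPoints B, IsRationalClass (complexBetti.map (fiberι f s) (2 * 2) A) ∧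
          IsOfHodgeType 4 (fiberOver f s) (2 * 2) 2 2 (complexBetti.map (fiberι f s) (2 * 2) A)) →
        (∃ s₀ : ComplexPoints B,
          complexBetti.map (fiberι f s₀) (2 * 2) A ∈ algebraicClasses (fiberOver f s₀) 2) →
        ∀ s : ComplexPoints B,
          complexBetti.map (fiberι f s) (2 * 2) A ∈ algebraicClasses (fiberOver f s) 2 := by
  sorry

/-- **X₃ from the two stubs** (used by name inside the proof; sorries live only in `stub_*`) and the
proved `AnchorTransport.IsoInvariance`: transport of the algebraicity of the E-class to every projective
target with TC — in particular along the E-isometry from the crux's Picard-18 anchor, whose data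
`S₀, J₀, g, g₄, [J₀] = [γ₀]_*` this line does not use. [cite: CharlesSchnell2014Notes, Cor. 11.3.6] -/
theorem EClassTransport_of : EClassTransport := by
  intro μ hμ S₀ S₁ hS₀ hS₁ m hm J₀ J₁ hJ₀ hJ₁ hrk hg hTC hγ₀
  obtain ⟨𝒳, B, f, s₁, s₀, e, A, t, hf, hirr, hsm, hsq, hA, hact, halg₀⟩ :=
    stub_EAnchoredFamily μ hμ S₁ hS₁ m hm J₁ hJ₁ hTC
  have halg₁ : complexBetti.map (fiberι f s₁) (2 * 2) A ∈ algebraicClasses (fiberOver f s₁) 2 :=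
    stub_variationalHodge_K3Squares f hf hirr hsm hsq A hA ⟨s₀, halg₀⟩ s₁
  exact ⟨t • complexBetti.map e.hom (2 * 2) (complexBetti.map (fiberι f s₁) (2 * 2) A),
    Submodule.smul_mem _ t (Theorems.anchorTransport_isoInvariance_proof e 2 _ halg₁), hact⟩

end Summit.HodgeConjecture.HodgeConjecture.Cruxes.EClassTransport.Birth
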